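import Literature.AnabelianGeometry.AbsoluteAnabelian.AbsTopII.TwoTripodNodalLogPoints
import HarnessLib

/-!
# [AbsTopII] Def 1.2 (ii) at the degenerating 4-pointed sphere WITH NODE INDEX `i`: the index-`i` two-vertex DPSC datum

S. Mochizuki, *Topics in Absolute Anabelian Geometry II* [AbsTopII] (bib `MochizukiAbsTopII2013`; locators =
PDF pages of the kurims manuscript `paper:url-585b8d0ad0d9`), §1, Example 1.1 (iii) p. 9 ("there exist elements
`ξ, η ∈ M_e` satisfying the relation `ξ + η = i_e · σ` for some positive integer `i_e`, which we shall refer to as the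
index of the node `e` […] we shall write `i^Σ_e` for the largest positive integer `j` such that `i_e/j` is a product of
primes `∉ Σ` and refer to `i^Σ_e` as the `Σ`-index of the node `e`"), Def 1.2 (ii) p. 10 ("Let `ρ_H : H → Aut(𝔾)` be a
continuous homomorphism of profinite groups; `ι : I^Σ_{S^log} ↪ H` a continuous injection of profinite groups with
normal image such that `ρ_H ∘ ι = ρ_I` […] `Π_I := Π_H ×_H I ⊆ Π_H` […] `I_v := Z_{Π_I}(Π_v)`, `I_e := Z_{Π_I}(Π_e)`"),
Remark 1.1.1 p. 9 ("it is not even necessary to assume that an 'additional profinite group' acting on `𝔾` arises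
'from scheme theory'").

MODEL/CONSTRUCTION file (definitions + their defining lemmas; abc-iut-f-066 gen 8, row «TWO-VERTEX-Σ-INDEX-i»;
cell layer L4, [AbsTopII] Prop 1.3 non-vacuity column), companion of `AbsTopII/TwoTripodNodalDatum.lean` (abc-iut-f-066
gen 5: the model `M : TwoTripodNodal.Model Σ` — a pro-`Σ` completion `ι : Γ_{0,4} ⋊_φ ℤ → P` of the Dehn-twist
extension of the 4-punctured sphere group, `Π_𝔾 = closure ι(Γ_{0,4})`, `T = closure ⟨t₀⟩` (`t₀ = ι(inr 1)`),
`U = closure ⟨u₀⟩` (`u₀ = w⁻¹ t₀`, `w = ι(c₁c₂)` the node element) — and its REGULAR-SMOOTHING datum `M.dpsc`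
(`Π_H = Π_I = P`, `i^Σ_e = 1`)).  Here, for a `Σ`-integer `i ≥ 1`, the SAME profinite data carry the DPSC datum of
the smoothing `xy = s^i` (node index `i_e = i`, monodromy = the `i`-th power of the Dehn twist):

* `Model.Tpow i := closure ⟨t₀^i⟩ ⊆ T`, `Model.Upow i := closure ⟨u₀^i⟩ ⊆ U`;
* `Model.PiIdx i := Π_𝔾 · closure ⟨t₀^i⟩` — the IPSC-extension `Π_I = Π_𝔾 ⋊^out I`, `I = i·Ẑ^Σ ≅ Ẑ^Σ` acting
  through `t₀^i ↦ (Dehn twist)^i`; a closed normal subgroup of `P` (`P/Π_𝔾 ≅ Ẑ^Σ` is abelian);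
* `Model.dpscIdx hne hprime i hi : DPSCIndexData` — abc-iut-f-069's `DPSCIndexData.ofEmbedding` of the two-tripod PSC
  datum `M.pscDatum` along `Π_𝔾 ↪ P` with `Π_H := P` (`H = P/Π_𝔾 ≅ Ẑ^Σ`, `ρ_H` = the outer Dehn-twist action),
  `Π_I := PiIdx i` (`ι : I = i·Ẑ^Σ ↪ H`, normal image since `H` is abelian, `ρ_H ∘ ι = ρ_I`) and `Σ`-index
  `i^Σ_e := i` (`hi : IsSigmaInteger Σ i`, so `i^Σ_e = i_e = i`).  Per Def 1.2 (ii) / Rmk 1.1.1 the profinite group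
  `H ⊋ I` is an admissible "additional profinite group" (an `i`-th root of the monodromy); at `i = 1` one recovers
  `M.dpsc` (`PiIdx_one`).
Defining lemmas: every DECOMPOSITION group of `dpscIdx` is that of `dpsc` (`rfl` — they are normalisers in the same
`Π_H = P`), every INERTIA group is the old one cut down to `Π_I^{(i)}` (`Iv_dpscIdx`, `IvNode_dpscIdx`); `T ∩ Π_I^{(i)}
= closure ⟨t₀^i⟩` (`T_inf_PiIdx`), whence `I_{v_A} = closure ⟨t₀^i⟩` (`Iv_zero_dpscIdx`).  The Prop 1.3 clauses at
`dpscIdx` — (ii′) with image index EXACTLY `i`, (x″) with log points OVER THE NODE — are PROVED in the proof-only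
companions `TwoTripodNodalIndexInertia.lean`, `TwoTripodNodalIndexProp13x.lean`; nothing is asserted here.
HONEST FRAMING: a constructed datum (constructed ≠ geometric: that these closed subgroups ARE the groups of the
degenerate curve with node index `i` is the model's label — Riemann existence / log specialisation are not in the
tree); no side taken on [IUTchIII] Cor 3.12; typed ≠ proved.
-/

noncomputable section

open scoped Pointwise

namespace Literature.AnabelianGeometry.AbsoluteAnabelian.AbsTopII.TwoTripodNodal.Model

open Literature.AnabelianGeometry.SemiGraphs
open Literature.AnabelianGeometry.SemiGraphs.SemiGraphOfAnabelioids (IsProSigmaCompletion)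
open Literature.AnabelianGeometry.SemiGraphs.SemiGraphOfAnabelioids.IsProSigmaCompletion
open Literature.AnabelianGeometry.Anabelioids (IsSigmaInteger)
open Literature.GroupTheory.CombinatorialGroupTheory
open Literature.GroupTheory.CombinatorialGroupTheory.PuncturedSurfaceGroup
open _root_.Topology

variable {Sigma : Set ℕ} (M : Model Sigma)

/-! ### The index-`i` sections `closure ⟨t₀^i⟩`, `closure ⟨u₀^i⟩` -/

/-- **`closure ⟨t₀^i⟩ ⊆ T`** — the inertia `I = i·Ẑ^Σ` of the smoothing `xy = s^i` inside `H = Ẑ^Σ`, realised on the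
completed section `T = closure ⟨t₀⟩` (it will be `I_{v_A}` of the index-`i` datum).
[cite: MochizukiAbsTopII2013, Def 1.2 (ii) p.10] -/
def Tpow (i : ℕ) : Subgroup M.P :=
  (Subgroup.zpowers (M.ι (SemidirectProduct.inr (Multiplicative.ofAdd (1 : ℤ))) ^ i)).topologicalClosure

/-- **`closure ⟨u₀^i⟩ ⊆ U`** (`u₀ = ι(inl (c₁c₂)⁻¹ · inr 1)` the generator of the twisted section; it will be `I_{v_B}`
of the index-`i` datum). [cite: MochizukiAbsTopII2013, Def 1.2 (ii) p.10] -/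
def Upow (i : ℕ) : Subgroup M.P :=
  (Subgroup.zpowers (M.ι (SemidirectProduct.inl (c 1 * c 2 : PuncturedSurfaceGroup 0 4)⁻¹ *
    SemidirectProduct.inr (Multiplicative.ofAdd (1 : ℤ))) ^ i)).topologicalClosure

/-- **`Π_I^{(i)} := Π_𝔾 · closure ⟨t₀^i⟩`** — the IPSC-extension `Π_I = Π_H ×_H I` of Def 1.2 (ii) for the inertia
`I = i·Ẑ^Σ ⊆ H = P/Π_𝔾 ≅ Ẑ^Σ`. [cite: MochizukiAbsTopII2013, Def 1.2 (ii) p.10] -/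
def PiIdx (i : ℕ) : Subgroup M.P := M.PiG ⊔ M.Tpow i

variable (i : ℕ)

/-- `t₀^i ∈ closure ⟨t₀^i⟩`. [cite: MochizukiAbsTopII2013, Def 1.2 (ii) p.10] -/
theorem t0_pow_mem_Tpow : M.ι (SemidirectProduct.inr (Multiplicative.ofAdd (1 : ℤ))) ^ i ∈ M.Tpow i :=
  Subgroup.le_topologicalClosure _ (Subgroup.mem_zpowers _)

/-- `u₀^i ∈ closure ⟨u₀^i⟩`. [cite: MochizukiAbsTopII2013, Def 1.2 (ii) p.10] -/
theorem u0_pow_mem_Upow : M.ι (SemidirectProduct.inl (c 1 * c 2 : PuncturedSurfaceGroup 0 4)⁻¹ *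
    SemidirectProduct.inr (Multiplicative.ofAdd (1 : ℤ))) ^ i ∈ M.Upow i :=
  Subgroup.le_topologicalClosure _ (Subgroup.mem_zpowers _)

/-- `closure ⟨t₀^i⟩ ⊆ T`. [cite: MochizukiAbsTopII2013, Def 1.2 (ii) p.10] -/
theorem Tpow_le_T : M.Tpow i ≤ M.T :=
  Subgroup.topologicalClosure_minimal _ ((Subgroup.zpowers_le).mpr (M.T.pow_mem M.t0_mem_T i))
    (Subgroup.isClosed_topologicalClosure _)

/-- `closure ⟨u₀^i⟩ ⊆ U`. [cite: MochizukiAbsTopII2013, Def 1.2 (ii) p.10] -/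
theorem Upow_le_U : M.Upow i ≤ M.U :=
  Subgroup.topologicalClosure_minimal _ ((Subgroup.zpowers_le).mpr (M.U.pow_mem M.u0_mem_U i))
    (Subgroup.isClosed_topologicalClosure _)

/-- `closure ⟨t₀^1⟩ = T`. [cite: MochizukiAbsTopII2013, Def 1.2 (ii) p.10] -/
theorem Tpow_one : M.Tpow 1 = M.T := by
  rw [Tpow, pow_one, Model.T, map_inr_range_eq_zpowers]

/-- `Π_𝔾 ⊆ Π_I^{(i)}`. [cite: MochizukiAbsTopII2013, Def 1.2 (ii) p.10] -/
theorem PiG_le_PiIdx : M.PiG ≤ M.PiIdx i := le_sup_left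

/-- `closure ⟨t₀^i⟩ ⊆ Π_I^{(i)}`. [cite: MochizukiAbsTopII2013, Def 1.2 (ii) p.10] -/
theorem Tpow_le_PiIdx : M.Tpow i ≤ M.PiIdx i := le_sup_right

/-- `Π_I^{(1)} = P` — the index-`1` datum is the regular smoothing `M.dpsc` (`Π_𝔾 · T = P`).
[cite: MochizukiAbsTopII2013, Def 1.2 (ii) p.10] -/
theorem PiIdx_one : M.PiIdx 1 = ⊤ := by
  rw [PiIdx, Tpow_one, PiG_sup_T]

/-- The carrier of `Π_I^{(i)} = Π_𝔾 ⊔ closure ⟨t₀^i⟩` is the product set `Π_𝔾 · closure ⟨t₀^i⟩` (`Π_𝔾` is normal).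
[cite: MochizukiAbsTopII2013, Def 1.2 (ii) p.10] -/
theorem coe_PiIdx : ((M.PiIdx i : Subgroup M.P) : Set M.P) = (M.PiG : Set M.P) * (M.Tpow i : Set M.P) := by
  haveI := M.normal_PiG
  rw [PiIdx, Subgroup.normal_mul]

/-- Every element of `Π_I^{(i)}` is `γ · k` with `γ ∈ Π_𝔾`, `k ∈ closure ⟨t₀^i⟩`. [cite: MochizukiAbsTopII2013, Def 1.2 (ii) p.10] -/
theorem exists_eq_mul_of_mem_PiIdx {x : M.P} (hx : x ∈ M.PiIdx i) :
    ∃ γ ∈ M.PiG, ∃ k ∈ M.Tpow i, x = γ * k := by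
  have hx' : x ∈ ((M.PiIdx i : Subgroup M.P) : Set M.P) := hx
  rw [coe_PiIdx] at hx'
  obtain ⟨γ, hγ, k, hk, rfl⟩ := Set.mem_mul.mp hx'
  exact ⟨γ, hγ, k, hk, rfl⟩

/-- **`Π_I^{(i)}` is closed** (the product of the closed normal `Π_𝔾` with a compact subgroup).
[cite: MochizukiAbsTopII2013, Def 1.2 (ii) p.10] -/
theorem isClosed_PiIdx : IsClosed ((M.PiIdx i : Subgroup M.P) : Set M.P) := by
  rw [coe_PiIdx]
  exact (M.isClosed_PiG.isCompact.mul (Subgroup.isClosed_topologicalClosure _).isCompact).isClosed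

/-- **`Π_I^{(i)}` is normal in `P`**: `P = Π_𝔾 · T` with `T` abelian, so conjugation by `γ t` fixes the coset
`k · Π_𝔾` of every `k ∈ closure ⟨t₀^i⟩ ⊆ T` (`P/Π_𝔾 ≅ Ẑ^Σ` is abelian; `ι(I)` has normal image in `H`).
[cite: MochizukiAbsTopII2013, Def 1.2 (ii) p.10] -/
theorem normal_PiIdx : (M.PiIdx i).Normal := by
  haveI := M.normal_PiG
  refine ⟨fun n hn g => ?_⟩
  obtain ⟨γ, hγ, k, hk, rfl⟩ := M.exists_eq_mul_of_mem_PiIdx i hn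
  obtain ⟨γ₁, hγ₁, t, ht, rfl⟩ := M.exists_eq_mul_of_sup_eq_top M.T_sup_PiG g
  have hkt : t * k = k * t := M.isFreeProSigmaCyclic_T.subgroup_comm t ht k (M.Tpow_le_T i hk)
  -- `γ₁ t (γ k) t⁻¹ γ₁⁻¹ = [γ₁ (tγt⁻¹) (k γ₁⁻¹ k⁻¹)] · k`
  have hcalc : γ₁ * t * (γ * k) * (γ₁ * t)⁻¹ = (γ₁ * (t * γ * t⁻¹) * (k * γ₁⁻¹ * k⁻¹)) * k := by
    calc γ₁ * t * (γ * k) * (γ₁ * t)⁻¹ = γ₁ * (t * γ * t⁻¹) * (t * k * t⁻¹) * γ₁⁻¹ := by group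
      _ = γ₁ * (t * γ * t⁻¹) * k * γ₁⁻¹ := by rw [hkt, mul_inv_cancel_right]
      _ = (γ₁ * (t * γ * t⁻¹) * (k * γ₁⁻¹ * k⁻¹)) * k := by group
  rw [hcalc]
  refine Subgroup.mul_mem _ (M.PiG_le_PiIdx i ?_) (M.Tpow_le_PiIdx i hk)
  exact M.PiG.mul_mem (M.PiG.mul_mem hγ₁ (Subgroup.Normal.conj_mem inferInstance γ hγ t))
    (Subgroup.Normal.conj_mem inferInstance _ (M.PiG.inv_mem hγ₁) k)

/-- **`T ∩ Π_I^{(i)} = closure ⟨t₀^i⟩`** (`T ∩ Π_𝔾 = 1`). [cite: MochizukiAbsTopII2013, Prop 1.3 (iii) p.11] -/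
theorem T_inf_PiIdx : M.T ⊓ M.PiIdx i = M.Tpow i := by
  refine le_antisymm ?_ (le_inf (M.Tpow_le_T i) (M.Tpow_le_PiIdx i))
  rintro x ⟨hxT, hxI⟩
  obtain ⟨γ, hγ, k, hk, rfl⟩ := M.exists_eq_mul_of_mem_PiIdx i hxI
  have hγT : γ ∈ M.T := by
    have h := M.T.mul_mem hxT (M.T.inv_mem (M.Tpow_le_T i hk))
    rwa [mul_inv_cancel_right] at h
  have hγ1 : γ = 1 := by
    rw [← Subgroup.mem_bot, ← M.T_inf_PiG]; exact ⟨hγT, hγ⟩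
  rw [hγ1, one_mul]; exact hk

/-- `closure ⟨t₀^i⟩ ∩ Π_𝔾 = 1`. [cite: MochizukiAbsTopII2013, Prop 1.3 (iii) p.11] -/
theorem Tpow_inf_PiG : M.Tpow i ⊓ M.PiG = ⊥ := by
  rw [eq_bot_iff, ← M.T_inf_PiG]; exact inf_le_inf_right _ (M.Tpow_le_T i)

/-- `closure ⟨u₀^i⟩ ∩ Π_𝔾 = 1`. [cite: MochizukiAbsTopII2013, Prop 1.3 (iii) p.11] -/
theorem Upow_inf_PiG (hne : Sigma.Nonempty) (hprime : ∀ p ∈ Sigma, p.Prime) : M.Upow i ⊓ M.PiG = ⊥ := by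
  rw [eq_bot_iff, ← M.U_inf_PiG hne hprime]; exact inf_le_inf_right _ (M.Upow_le_U i)

/-- `closure ⟨t₀^i⟩ · Π_𝔾 = Π_I^{(i)}`. [cite: MochizukiAbsTopII2013, Prop 1.3 (iii) p.11] -/
theorem Tpow_sup_PiG : M.Tpow i ⊔ M.PiG = M.PiIdx i := sup_comm _ _

/-! ### The same subgroups inside the subtypes `↥T`, `↥U`, `↥Π_e` (for index computations) -/

/-- Pushing a closure out of a CLOSED subgroup `H ⊆ P`: `H.subtype (closure K) = closure (H.subtype K)` (closed
embedding). [cite: MochizukiAbsTopII2013, Def 1.2 (ii) p.10] -/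
theorem map_subtype_topologicalClosure_of_isClosed {H : Subgroup M.P} (hH : IsClosed (H : Set M.P))
    (K : Subgroup ↥H) : (K.topologicalClosure).map H.subtype = (K.map H.subtype).topologicalClosure := by
  apply SetLike.coe_injective
  rw [Subgroup.coe_map, Subgroup.topologicalClosure_coe, Subgroup.topologicalClosure_coe, Subgroup.coe_map,
    Subgroup.coe_subtype]
  exact (hH.isClosedEmbedding_subtypeVal.closure_image_eq _).symm

/-- If `H = closure ⟨x⟩` in `P`, then `⟨x⟩` is dense in the subspace `↥H`. [cite: MochizukiAbsTopII2013, Prop 1.3 (i) p.11] -/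
theorem dense_zpowers_of_eq_topologicalClosure {H : Subgroup M.P} {x : M.P}
    (hH : H = (Subgroup.zpowers x).topologicalClosure) (hx : x ∈ H) :
    Dense (Subgroup.zpowers (⟨x, hx⟩ : ↥H) : Set ↥H) := by
  rw [Subtype.dense_iff]
  intro y hy
  have hy' : y ∈ closure ((Subgroup.zpowers x : Subgroup M.P) : Set M.P) := by
    rw [← Subgroup.topologicalClosure_coe, ← hH]; exact hy
  refine closure_mono (fun z hz => ?_) hy'
  obtain ⟨k, rfl⟩ := Subgroup.mem_zpowers_iff.mp hz
  exact ⟨(⟨x, hx⟩ : ↥H) ^ k, Subgroup.mem_zpowers_iff.mpr ⟨k, rfl⟩, by simp⟩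

/-- `T = closure ⟨t₀⟩`. [cite: MochizukiAbsTopII2013, Prop 1.3 (iii) p.11] -/
theorem T_eq_closure_zpowers_t0 :
    M.T = (Subgroup.zpowers (M.ι (SemidirectProduct.inr (Multiplicative.ofAdd (1 : ℤ))))).topologicalClosure := by
  rw [Model.T, map_inr_range_eq_zpowers]

/-- The node element `w = ι(inl (c₁c₂))` lies in `ι(Π_e) = closure ⟨w⟩`. [cite: MochizukiAbsTopII2013, Def 1.2 (ii) p.10] -/
theorem ι_node_mem_W : M.ι (SemidirectProduct.inl (c 1 * c 2 : PuncturedSurfaceGroup 0 4)) ∈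
    (M.nodeGp).map M.PiG.subtype := by
  rw [nodeGp_map_eq]; exact Subgroup.le_topologicalClosure _ (Subgroup.mem_zpowers _)

/-- `⟨t₀⟩` is dense in `↥T`. [cite: MochizukiAbsTopII2013, Prop 1.3 (iii) p.11] -/
theorem dense_zpowers_tT : Dense (Subgroup.zpowers
    (⟨M.ι (SemidirectProduct.inr (Multiplicative.ofAdd (1 : ℤ))), M.t0_mem_T⟩ : ↥M.T) : Set ↥M.T) :=
  M.dense_zpowers_of_eq_topologicalClosure M.T_eq_closure_zpowers_t0 _

/-- `⟨u₀⟩` is dense in `↥U`. [cite: MochizukiAbsTopII2013, Prop 1.3 (iii) p.11] -/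
theorem dense_zpowers_uU : Dense (Subgroup.zpowers
    (⟨M.ι (SemidirectProduct.inl (c 1 * c 2 : PuncturedSurfaceGroup 0 4)⁻¹ *
      SemidirectProduct.inr (Multiplicative.ofAdd (1 : ℤ))), M.u0_mem_U⟩ : ↥M.U) : Set ↥M.U) :=
  M.dense_zpowers_of_eq_topologicalClosure rfl _

/-- `⟨w⟩` is dense in `↥ι(Π_e)`. [cite: MochizukiCombGC2007, Def 1.1(ii) p.7] -/
theorem dense_zpowers_wW : Dense (Subgroup.zpowers
    (⟨M.ι (SemidirectProduct.inl (c 1 * c 2 : PuncturedSurfaceGroup 0 4)), M.ι_node_mem_W⟩ :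
      ↥((M.nodeGp).map M.PiG.subtype)) : Set ↥((M.nodeGp).map M.PiG.subtype)) :=
  M.dense_zpowers_of_eq_topologicalClosure M.nodeGp_map_eq _

/-- `closure ⟨t₀^i⟩` taken INSIDE `↥T` (an open subgroup of index `i` of `T ≅ Ẑ^Σ` when `i` is a `Σ`-integer).
[cite: MochizukiAbsTopII2013, Def 1.2 (ii) p.10] -/
def TpowT (i : ℕ) : Subgroup ↥M.T :=
  (Subgroup.zpowers ((⟨M.ι (SemidirectProduct.inr (Multiplicative.ofAdd (1 : ℤ))), M.t0_mem_T⟩ : ↥M.T) ^ i)).topologicalClosure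

/-- `closure ⟨u₀^i⟩` taken INSIDE `↥U`. [cite: MochizukiAbsTopII2013, Def 1.2 (ii) p.10] -/
def UpowU (i : ℕ) : Subgroup ↥M.U :=
  (Subgroup.zpowers ((⟨M.ι (SemidirectProduct.inl (c 1 * c 2 : PuncturedSurfaceGroup 0 4)⁻¹ *
    SemidirectProduct.inr (Multiplicative.ofAdd (1 : ℤ))), M.u0_mem_U⟩ : ↥M.U) ^ i)).topologicalClosure

/-- `closure ⟨w^i⟩ ⊆ P` (`w = ι(c₁c₂)`): the index-`i` subgroup of `ι(Π_e) ≅ Ẑ^Σ`.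
[cite: MochizukiAbsTopII2013, Prop 1.3 (ii) p.11] -/
def Wpow (i : ℕ) : Subgroup M.P :=
  (Subgroup.zpowers (M.ι (SemidirectProduct.inl (c 1 * c 2 : PuncturedSurfaceGroup 0 4)) ^ i)).topologicalClosure

/-- `closure ⟨w^i⟩` taken INSIDE `↥ι(Π_e)`. [cite: MochizukiAbsTopII2013, Prop 1.3 (ii) p.11] -/
def WpowW (i : ℕ) : Subgroup ↥((M.nodeGp).map M.PiG.subtype) :=
  (Subgroup.zpowers ((⟨M.ι (SemidirectProduct.inl (c 1 * c 2 : PuncturedSurfaceGroup 0 4)), M.ι_node_mem_W⟩ :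
    ↥((M.nodeGp).map M.PiG.subtype)) ^ i)).topologicalClosure

/-- `T.subtype (TpowT i) = Tpow i`. [cite: MochizukiAbsTopII2013, Def 1.2 (ii) p.10] -/
theorem TpowT_map_subtype : (M.TpowT i).map M.T.subtype = M.Tpow i := by
  rw [TpowT, M.map_subtype_topologicalClosure_of_isClosed (H := M.T) (Subgroup.isClosed_topologicalClosure _),
    MonoidHom.map_zpowers, map_pow, Subgroup.coe_subtype]
  rfl

/-- `U.subtype (UpowU i) = Upow i`. [cite: MochizukiAbsTopII2013, Def 1.2 (ii) p.10] -/
theorem UpowU_map_subtype : (M.UpowU i).map M.U.subtype = M.Upow i := by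
  rw [UpowU, M.map_subtype_topologicalClosure_of_isClosed (H := M.U) (Subgroup.isClosed_topologicalClosure _),
    MonoidHom.map_zpowers, map_pow, Subgroup.coe_subtype]
  rfl

/-- `W.subtype (WpowW i) = Wpow i`. [cite: MochizukiAbsTopII2013, Prop 1.3 (ii) p.11] -/
theorem WpowW_map_subtype : (M.WpowW i).map ((M.nodeGp).map M.PiG.subtype).subtype = M.Wpow i := by
  rw [WpowW, M.map_subtype_topologicalClosure_of_isClosed M.isClosed_W, MonoidHom.map_zpowers, map_pow,
    Subgroup.coe_subtype]
  rfl

/-- `(Tpow i) ∩ T`, read in `↥T`, is `TpowT i`. [cite: MochizukiAbsTopII2013, Def 1.2 (ii) p.10] -/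
theorem Tpow_subgroupOf_T : (M.Tpow i).subgroupOf M.T = M.TpowT i := by
  rw [← TpowT_map_subtype]; exact Subgroup.comap_map_eq_self_of_injective (Subgroup.subtype_injective _) _

/-- `(Upow i) ∩ U`, read in `↥U`, is `UpowU i`. [cite: MochizukiAbsTopII2013, Def 1.2 (ii) p.10] -/
theorem Upow_subgroupOf_U : (M.Upow i).subgroupOf M.U = M.UpowU i := by
  rw [← UpowU_map_subtype]; exact Subgroup.comap_map_eq_self_of_injective (Subgroup.subtype_injective _) _

/-- `(Wpow i) ∩ W`, read in `↥W`, is `WpowW i`. [cite: MochizukiAbsTopII2013, Prop 1.3 (ii) p.11] -/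
theorem Wpow_subgroupOf_W : (M.Wpow i).subgroupOf ((M.nodeGp).map M.PiG.subtype) = M.WpowW i := by
  rw [← WpowW_map_subtype]; exact Subgroup.comap_map_eq_self_of_injective (Subgroup.subtype_injective _) _

/-- `closure ⟨w^i⟩ ⊆ ι(Π_e)`. [cite: MochizukiAbsTopII2013, Prop 1.3 (ii) p.11] -/
theorem Wpow_le_W : M.Wpow i ≤ (M.nodeGp).map M.PiG.subtype := by
  rw [← WpowW_map_subtype]; exact Subgroup.map_subtype_le _

/-- `w^i ∈ closure ⟨w^i⟩`. [cite: MochizukiAbsTopII2013, Prop 1.3 (ii) p.11] -/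
theorem w_pow_mem_Wpow : M.ι (SemidirectProduct.inl (c 1 * c 2 : PuncturedSurfaceGroup 0 4)) ^ i ∈ M.Wpow i :=
  Subgroup.le_topologicalClosure _ (Subgroup.mem_zpowers _)

/-! ### The index-`i` DPSC datum -/

/-- `Π_𝔾 = range (Π_𝔾 ↪ P) ⊆ Π_I^{(i)}`. [cite: MochizukiAbsTopII2013, Def 1.2 (ii) p.10] -/
theorem range_subtype_le_PiIdx : M.PiG.subtype.range ≤ M.PiIdx i := by
  rw [Subgroup.range_subtype]; exact M.PiG_le_PiIdx i

/-- **The index-`i` DPSC datum of the degenerating 4-pointed sphere** (Def 1.2 (ii) with Ex 1.1 (iii)): the two-tripod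
PSC datum `M.pscDatum` embedded in `Π_H := P` (`H = P/Π_𝔾 ≅ Ẑ^Σ` acting through the Dehn twist along the node),
with `Π_I := Π_𝔾 · closure ⟨t₀^i⟩` (`I = i·Ẑ^Σ ⊆ H`: the monodromy of the smoothing `xy = s^i` is the `i`-th power of
the twist) and `Σ`-index of the node `i^Σ_e := i` (`i` a `Σ`-integer).  Two vertices `v_A, v_B`, one non-loop node,
cusps `c₁, c₂ | c₃, c₀`; at `i = 1` this is `M.dpsc`. [cite: MochizukiAbsTopII2013, Def 1.2 (ii) p.10] -/
def dpscIdx (hne : Sigma.Nonempty) (hprime : ∀ p ∈ Sigma, p.Prime) (i : ℕ) (hi : IsSigmaInteger Sigma i) :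
    DPSCIndexData.{0} :=
  DPSCIndexData.ofEmbedding (M.pscDatum hne hprime) M.P M.PiG.subtype M.isClosed_range_subtype
    M.normal_range_subtype (M.PiIdx i) (M.normal_PiIdx i) (M.range_subtype_le_PiIdx i) (fun _ => i) (fun _ => hi)

variable (hne : Sigma.Nonempty) (hprime : ∀ p ∈ Sigma, p.Prime) (hi : IsSigmaInteger Sigma i)

/-- The DPSC data of `dpscIdx` is the embedded two-tripod datum with `Π_I = Π_I^{(i)}` (`rfl`).
[cite: MochizukiAbsTopII2013, Def 1.2 (ii) p.10] -/
theorem dpscIdx_toDPSCData :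
    (M.dpscIdx hne hprime i hi).toDPSCData = DPSCData.ofEmbedding (M.pscDatum hne hprime) M.P M.PiG.subtype
      M.isClosed_range_subtype M.normal_range_subtype (M.PiIdx i) (M.normal_PiIdx i) (M.range_subtype_le_PiIdx i) :=
  rfl

/-- The node of `dpscIdx` has `Σ`-index `i`. [cite: MochizukiAbsTopII2013, Ex 1.1 (iii) p.9] -/
theorem dpscIdx_sigmaIndex (e : (M.dpscIdx hne hprime i hi).Node) : (M.dpscIdx hne hprime i hi).sigmaIndex e = i := rfl

/-- `Σ` of `dpscIdx` is the model's `Σ`. [cite: MochizukiAbsTopII2013, Ex 1.1 (i) p.8] -/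
theorem dpscIdx_Sigma : (M.dpscIdx hne hprime i hi).Sigma = Sigma := rfl

/-- `Π_𝔾` of `dpscIdx` is `Π_𝔾 = closure ι(inl Γ_{0,4})`. [cite: MochizukiAbsTopII2013, Def 1.2 (ii) p.10] -/
theorem dpscIdx_PiG : (M.dpscIdx hne hprime i hi).PiG = M.PiG := Subgroup.range_subtype _

/-- `Π_I` of `dpscIdx` is `Π_I^{(i)} = Π_𝔾 · closure ⟨t₀^i⟩`. [cite: MochizukiAbsTopII2013, Def 1.2 (ii) p.10] -/
theorem dpscIdx_PiI : (M.dpscIdx hne hprime i hi).PiI = M.PiIdx i := rfl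

/-- `Π_v` of `dpscIdx` is `Π_v` of `dpsc`. [cite: MochizukiAbsTopII2013, Def 1.2 (ii) p.10] -/
theorem dpscIdx_vertSub (v : (M.dpscIdx hne hprime i hi).Vert) :
    (M.dpscIdx hne hprime i hi).vertSub v = (M.dpsc hne hprime).vertSub v := rfl

/-- `Π_e` (node) of `dpscIdx` is `Π_e` of `dpsc`. [cite: MochizukiAbsTopII2013, Def 1.2 (ii) p.10] -/
theorem dpscIdx_nodeSub (e : (M.dpscIdx hne hprime i hi).Node) :
    (M.dpscIdx hne hprime i hi).nodeSub e = (M.dpsc hne hprime).nodeSub e := rfl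

/-- `Π_e` (cusp) of `dpscIdx` is `Π_e` of `dpsc`. [cite: MochizukiAbsTopII2013, Def 1.2 (ii) p.10] -/
theorem dpscIdx_cuspSub (e : (M.dpscIdx hne hprime i hi).Cusp) :
    (M.dpscIdx hne hprime i hi).cuspSub e = (M.dpsc hne hprime).cuspSub e := rfl

/-- The incidence of `dpscIdx` is that of `dpsc`: every node abuts to every vertex. [cite: MochizukiAbsTopII2013, Ex 1.1 (ii) p.9] -/
theorem nodeAbuts_dpscIdx (e : (M.dpscIdx hne hprime i hi).Node) (v : (M.dpscIdx hne hprime i hi).Vert) :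
    (M.dpscIdx hne hprime i hi).nodeAbuts e v :=
  M.nodeAbuts_dpsc hne hprime e v

/-- A vertex of `dpscIdx` is `v_A` or `v_B`. [cite: MochizukiAbsTopII2013, Ex 1.1 (ii) p.9] -/
theorem vert_cases_dpscIdx (v : (M.dpscIdx hne hprime i hi).Vert) : v = ⟨(0 : Fin 2)⟩ ∨ v = ⟨(1 : Fin 2)⟩ :=
  M.vert_cases hne hprime v

/-! ### Decomposition groups: unchanged; inertia groups: cut down to `Π_I^{(i)}` -/

/-- **`D_v` of `dpscIdx` IS `D_v` of `dpsc`** (normalisers in the same `Π_H = P`; `rfl`).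
[cite: MochizukiAbsTopII2013, Def 1.2 (ii) p.10] -/
theorem Dv_dpscIdx (v : (M.dpscIdx hne hprime i hi).Vert) :
    (M.dpscIdx hne hprime i hi).Dv v = (M.dpsc hne hprime).Dv v := rfl

/-- **`D_e` (node) of `dpscIdx` IS `D_e` of `dpsc`** (`rfl`). [cite: MochizukiAbsTopII2013, Def 1.2 (ii) p.10] -/
theorem DvNode_dpscIdx (e : (M.dpscIdx hne hprime i hi).Node) :
    (M.dpscIdx hne hprime i hi).DvNode e = (M.dpsc hne hprime).DvNode e := rfl

/-- **`D_e` (cusp) of `dpscIdx` IS `D_e` of `dpsc`** (`rfl`). [cite: MochizukiAbsTopII2013, Def 1.2 (ii) p.10] -/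
theorem DvCusp_dpscIdx (e : (M.dpscIdx hne hprime i hi).Cusp) :
    (M.dpscIdx hne hprime i hi).DvCusp e = (M.dpsc hne hprime).DvCusp e := rfl

/-- `I_e` (cusp) of `dpscIdx` IS `I_e = Π_e` of `dpsc` (`rfl`). [cite: MochizukiAbsTopII2013, Def 1.2 (ii) p.10] -/
theorem IvCusp_dpscIdx (e : (M.dpscIdx hne hprime i hi).Cusp) :
    (M.dpscIdx hne hprime i hi).IvCusp e = (M.dpsc hne hprime).IvCusp e := rfl

/-- **`I_v` of `dpscIdx` is `I_v` of `dpsc` cut down to `Π_I^{(i)}`**: `Z_{Π_I^{(i)}}(Π_v) = Z_P(Π_v) ∩ Π_I^{(i)}`.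
[cite: MochizukiAbsTopII2013, Def 1.2 (ii) p.10] -/
theorem Iv_dpscIdx (v : (M.dpscIdx hne hprime i hi).Vert) :
    (M.dpscIdx hne hprime i hi).Iv v = (M.dpsc hne hprime).Iv v ⊓ M.PiIdx i := by
  unfold DPSCData.Iv
  rw [dpsc_PiI, inf_top_eq]
  rfl

/-- **`I_e` (node) of `dpscIdx` is `I_e` of `dpsc` cut down to `Π_I^{(i)}`.** [cite: MochizukiAbsTopII2013, Def 1.2 (ii) p.10] -/
theorem IvNode_dpscIdx (e : (M.dpscIdx hne hprime i hi).Node) :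
    (M.dpscIdx hne hprime i hi).IvNode e = (M.dpsc hne hprime).IvNode e ⊓ M.PiIdx i := by
  unfold DPSCData.IvNode
  rw [dpsc_PiI, inf_top_eq]
  rfl

/-- **`I_{v_A} = closure ⟨t₀^i⟩`** at the index-`i` datum (`I_{v_A}(dpsc) = T` and `T ∩ Π_I^{(i)} = closure ⟨t₀^i⟩`).
[cite: MochizukiAbsTopII2013, Prop 1.3 (iii) p.11] -/
theorem Iv_zero_dpscIdx : (M.dpscIdx hne hprime i hi).Iv ⟨(0 : Fin 2)⟩ = M.Tpow i := by
  have h1 := M.Iv_dpscIdx i hne hprime hi ⟨(0 : Fin 2)⟩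
  rw [M.Iv_eq_T hne hprime] at h1
  rw [h1]
  exact M.T_inf_PiIdx i

/-- `I_v(dpscIdx) ⊆ I_v(dpsc)`. [cite: MochizukiAbsTopII2013, Def 1.2 (ii) p.10] -/
theorem Iv_dpscIdx_le (v : (M.dpscIdx hne hprime i hi).Vert) :
    (M.dpscIdx hne hprime i hi).Iv v ≤ (M.dpsc hne hprime).Iv v := by
  rw [Iv_dpscIdx]; exact inf_le_left

/-- `I_e(dpscIdx) ⊆ I_e(dpsc) = Π_e · T`. [cite: MochizukiAbsTopII2013, Def 1.2 (ii) p.10] -/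
theorem IvNode_dpscIdx_le (e : (M.dpscIdx hne hprime i hi).Node) :
    (M.dpscIdx hne hprime i hi).IvNode e ≤ (M.nodeGp).map M.PiG.subtype ⊔ M.T := by
  rw [IvNode_dpscIdx, IvNode_eq_J]; exact inf_le_left

end Literature.AnabelianGeometry.AbsoluteAnabelian.AbsTopII.TwoTripodNodal.Model

end
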